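import Summits.ABC.IUTFork.LDHGenuinePerImageRamificationRat
import HarnessLib

/-!
# The fork at [IUTchIII] Corollary 3.12, L-DH level, READING (P): the hypothesis-free rational-point sufficiency SHARPENED by
# `√−1 ∈ F`, `μ₃₀ ⊂ F` and the `30`-th root of the Tate parameter (abc-iut cell, crux ThetaPartII = stmt-ABC-19678; row
# «C:PERIMAGE-DIFFSHARP», part 3 of 3)

Record-only PROOF file (D-0012) of the abc-iut cell (WAVE-3 discharge seat abc-iut-c312-d1, gen 9). TAKES NO SIDE on
[IUTchIII] Cor. 3.12. abc-iut-s2-p4's `Cor22.cor312PerImageOf_ratPoint_of_le` (p471287) tests, at a rational point `q` and a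
prime `l`, `κ_l·log q^{∤2l} ≤ ((l+5)/4 − 1)·((1 − 1/l)·log 𝔣^{∤2l} + (1 − 1/(l−1))·log l) + ((l+5)/4)·log π`, i.e. it weights the
Step (ii) different bound by `l` at the bad places and `l − 1` at `l`. With part 1's per-place weights
(`cor312PerImageOf_of_le_weighted`) and part 2's divisibilities the SAME conclusion — `T.Cor312PerImageOf` at EVERY genuine
Θ-volume datum `T` of `(q, l)` — follows from the weaker

  `κ_l·log q^{∤2l}(q) ≤ ((l+5)/4 − 1)·( Σ_{p∈I, p≠2, p≠l} (1 − 1/(l·lcm(30/gcd(30,e_p), c_p)))·log p + ½·log 2 + [3∉I]·½·log 3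
   + [5∉I]·¾·log 5 + (1 − 1/(l−1))·log l ) + ((l+5)/4)·log π`

(**`Cor22.cor312PerImageOf_ratPoint_sharp`**; `j(q) = N/∏_{p∈I} p^{e_p}`, `c_3 = 2`, `c_5 = 4`, else `c_p = 1`;
`κ_l = (l+1)/24 − 1/(2l)`; `l ≥ 7`). READING (the seat's desk note, numbers about OUR typed objects): on the 87 (triple, l)
TARGET pairs of the abc-iut R-W table left UNDECIDED by p471287's weights the sharpening adds `Σ_{p∣abc, p∤2l}(1/l −
1/(l·r_p·c_p))·log p + ½log 2 (+ ½log 3, + ¾log 5)` to the margin and decides 28 of them (row files follow). Nothing here asserts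
the existence of Θ-data, Cor. 3.12 in general or in print's reading, or abc; proved-as-typed ≠ in print.
[cite: Mochizuki2012, IUTchI Def. 3.1 (a)(b)(c) p. 61–62; IUTchIII Cor. 3.12 p. 173–174; IUTchIV Thm. 1.10 p. 22, Step (ii) p. 24,
Step (v) p. 27–29] [cite: MochizukiGenEll2010, Prop. 1.7 (i) p. 9–10] [cite: SilvermanAEC2009, Cor. III.8.1.1]
[cite: SilvermanATAEC1994, V.5 Thm. 5.3] [claim: Mochizuki2012, status: disputed] for every IUT quotation. PROOF-ONLY: no
definitions, no new `Prop`.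
-/

noncomputable section

open NumberField IsDedekindDomain Ideal Module

namespace Literature.IUT.LogVolume.Cor22

open Literature.NumberTheory.DiophantineGeometry.GenEll Summit.ABC.IUTFork Literature.IUT.HodgeTheaters
open Literature.NumberTheory.NumberFields
open Literature.NumberTheory.DiophantineGeometry.UniformABCConjecture Rat.HeightOneSpectrum

/-! ### Bookkeeping: sums over the places of `ℚ` above a finite set of primes -/

section Bookkeeping

variable {l : ℕ} {I : Finset ℕ} {e : ℕ → ℕ}

/-- Rearranging the weight sum over `I^{≠2,l} ∪ ({2, l} ∪ ({3, 5} ∖ I))` into the row-normal form. [folklore] -/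
private theorem sum_weights_eq (h7 : 7 ≤ l) (m' : ℕ → ℕ)
    (hmA : ∀ p ∈ I.filter (fun p => p ≠ 2 ∧ p ≠ l),
      m' p = l * Nat.lcm (30 / Nat.gcd 30 (e p)) (if p = 3 then 2 else if p = 5 then 4 else 1))
    (hm2 : m' 2 = 2) (hml : m' l = l - 1) (hm3 : 3 ∉ I → m' 3 = 2) (hm5 : 5 ∉ I → m' 5 = 4) :
    ∑ p ∈ I.filter (fun p => p ≠ 2 ∧ p ≠ l) ∪ ({2, l} ∪ ({3, 5} \ I)),
        (1 - (m' p : ℝ)⁻¹) * Real.log p =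
      (∑ p ∈ I.filter (fun p => p ≠ 2 ∧ p ≠ l),
          (1 - ((l * Nat.lcm (30 / Nat.gcd 30 (e p)) (if p = 3 then 2 else if p = 5 then 4 else 1) : ℕ) : ℝ)⁻¹)
            * Real.log p)
        + 2⁻¹ * Real.log 2
        + (if 3 ∈ I then 0 else 2⁻¹ * Real.log 3)
        + (if 5 ∈ I then 0 else (3 / 4 : ℝ) * Real.log 5)
        + (1 - ((l - 1 : ℕ) : ℝ)⁻¹) * Real.log l := by
  have hl2 : l ≠ 2 := by omega
  have hl3 : l ≠ 3 := by omega
  have hl5 : l ≠ 5 := by omega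
  -- the three pieces are pairwise disjoint
  have hdisjA : Disjoint (I.filter (fun p => p ≠ 2 ∧ p ≠ l)) ({2, l} ∪ ({3, 5} \ I)) := by
    refine Finset.disjoint_left.mpr fun p hpA hpB => ?_
    obtain ⟨hpI, hP⟩ := Finset.mem_filter.mp hpA
    rcases Finset.mem_union.mp hpB with h | h
    · simp only [Finset.mem_insert, Finset.mem_singleton] at h
      omega
    · exact (Finset.mem_sdiff.mp h).2 hpI
  have hdisjB : Disjoint ({2, l} : Finset ℕ) ({3, 5} \ I) := by
    refine Finset.disjoint_left.mpr fun p hp hp' => ?_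
    have h35 := (Finset.mem_sdiff.mp hp').1
    simp only [Finset.mem_insert, Finset.mem_singleton] at hp h35
    omega
  rw [Finset.sum_union hdisjA, Finset.sum_union hdisjB]
  -- piece A
  have hA : ∑ p ∈ I.filter (fun p => p ≠ 2 ∧ p ≠ l), (1 - (m' p : ℝ)⁻¹) * Real.log p =
      ∑ p ∈ I.filter (fun p => p ≠ 2 ∧ p ≠ l),
        (1 - ((l * Nat.lcm (30 / Nat.gcd 30 (e p)) (if p = 3 then 2 else if p = 5 then 4 else 1) : ℕ) : ℝ)⁻¹)
          * Real.log p :=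
    Finset.sum_congr rfl fun p hp => by rw [hmA p hp]
  -- piece B
  have hB : ∑ p ∈ ({2, l} : Finset ℕ), (1 - (m' p : ℝ)⁻¹) * Real.log p =
      2⁻¹ * Real.log 2 + (1 - ((l - 1 : ℕ) : ℝ)⁻¹) * Real.log l := by
    rw [Finset.sum_pair hl2.symm, hm2, hml]
    norm_num
  -- piece C
  have hC : ∑ p ∈ ({3, 5} : Finset ℕ) \ I, (1 - (m' p : ℝ)⁻¹) * Real.log p =
      (if 3 ∈ I then 0 else 2⁻¹ * Real.log 3) + (if 5 ∈ I then 0 else (3 / 4 : ℝ) * Real.log 5) := by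
    rw [Finset.sdiff_eq_filter, Finset.sum_filter, Finset.sum_pair (by norm_num : (3 : ℕ) ≠ 5)]
    congr 1
    · by_cases h3 : 3 ∈ I
      · rw [if_neg (not_not.mpr h3), if_pos h3]
      · rw [if_pos h3, if_neg h3, hm3 h3]; norm_num
    · by_cases h5 : 5 ∈ I
      · rw [if_neg (not_not.mpr h5), if_pos h5]
      · rw [if_pos h5, if_neg h5, hm5 h5]; norm_num
  rw [hA, hB, hC]
  ring

end Bookkeeping

/-! ### The sharpened hypothesis-free test at a rational point -/

variable {q : ℚ} {l : ℕ} {N D : ℕ} {I : Finset ℕ} {e : ℕ → ℕ}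

/-- **RATIONAL POINTS, SHARPENED UNCONDITIONAL FORM.** Let `q ∈ ℚ ∖ {0, 1}` with `j(q) = N/∏_{p∈I} p^{e_p}` (`I` primes with
`e_p ≥ 1`, `p ∤ N`), and `l ≥ 7` a prime. If
`((l+1)/24 − 1/(2l))·log q^{∤2l}(q) ≤ ((l+5)/4 − 1)·( Σ_{p∈I, p≠2, p≠l} (1 − 1/(l·lcm(30/gcd(30,e_p), c_p)))·log p + ½·log 2
+ [3∉I]·½·log 3 + [5∉I]·¾·log 5 + (1 − 1/(l−1))·log l ) + ((l+5)/4)·log π` (`c_3 = 2`, `c_5 = 4`, else `c_p = 1`), then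
`T.Cor312PerImageOf` — [IUTchIII] Cor. 3.12 in the cell's READING (P), AS TYPED — holds at EVERY genuine Θ-volume datum `T` of
`(q, l)`. The weights are THEOREMS at every `T`: `l·(30/gcd(30,e_p)) ∣ e(w∣p)` at the bad places (`l ∣ e(w∣x)`, [IUTchI] Def. 3.1
(c) + Ex. 3.2 (iv); `(30/gcd(30,e_p)) ∣ e(x∣p)`, the `30`-th root of the Tate parameter), `2 ∣ e(w∣2)` (`√−1 ∈ F`), `2 ∣ e(w∣3)`,
`4 ∣ e(w∣5)` (`μ₃₀ ⊂ F`), `(l−1) ∣ e(w∣l)` (`μ_l ⊂ K`); abc-iut-s2-p4's `cor312PerImageOf_ratPoint_of_le` (p471287) is the same test with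
the weights `l`, `1`, `1`, `1`, `l − 1`. [cite: Mochizuki2012, IUTchI Def. 3.1 (a)(b)(c) p. 61–62; IUTchIII Cor. 3.12 p. 173–174;
IUTchIV Thm. 1.10 p. 22, Step (ii) p. 24, Step (v) p. 27–29] [cite: MochizukiGenEll2010, Prop. 1.7 (i) p. 9–10]
[cite: SilvermanAEC2009, Cor. III.8.1.1] [cite: SilvermanATAEC1994, V.5 Thm. 5.3] [claim: Mochizuki2012, status: disputed] -/
theorem cor312PerImageOf_ratPoint_sharp (hq0 : q ≠ 0) (hq1 : q ≠ 1) (hl : l.Prime) (h7 : 7 ≤ l)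
    (hI : ∀ p ∈ I, p.Prime) (he : ∀ p ∈ I, e p ≠ 0) (hD : D = ∏ p ∈ I, p ^ e p)
    (hj : jInv q = (N : ℚ) / (D : ℚ)) (hN : N ≠ 0) (hcop : ∀ p ∈ I, ¬ p ∣ N)
    (h : (((l : ℝ) + 1) / 24 - 1 / (2 * l)) * logQAvoid (ratPoint q) {2, l} ≤
      (((l : ℝ) + 5) / 4 - 1) *
          ((∑ p ∈ I.filter (fun p => p ≠ 2 ∧ p ≠ l),
              (1 - ((l * Nat.lcm (30 / Nat.gcd 30 (e p)) (if p = 3 then 2 else if p = 5 then 4 else 1) : ℕ) : ℝ)⁻¹)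
                * Real.log p)
            + 2⁻¹ * Real.log 2
            + (if 3 ∈ I then 0 else 2⁻¹ * Real.log 3)
            + (if 5 ∈ I then 0 else (3 / 4 : ℝ) * Real.log 5)
            + (1 - ((l - 1 : ℕ) : ℝ)⁻¹) * Real.log l)
        + ((l : ℝ) + 5) / 4 * Real.log Real.pi)
    (T : ThetaVolumeDatumAt (ratPoint q) l) : T.Cor312PerImageOf := by
  classical
  letI := T.instFieldF; letI := T.instNumberFieldF; letI := T.instAlgebraF; letI := T.instFieldK
  letI := T.instNumberFieldK; letI := T.instAlgebraK
  letI : Algebra (ratPoint q).F T.K := ((algebraMap T.F T.K).comp (algebraMap (ratPoint q).F T.F)).toAlgebra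
  have hUP := ratPoint_mem_UPle_one hq0 hq1
  have hd1 : dmod (ratPoint q) = 1 := dmod_eq_one_of_degree_le_one (le_of_eq (degree_ratPoint _))
  have hl2 : l ≠ 2 := by omega
  have hl3 : l ≠ 3 := by omega
  have hl5 : l ≠ 5 := by omega
  -- the primes carrying a weight, and the weights
  obtain ⟨Ps, hPs⟩ : ∃ Ps : Finset ℕ, Ps = I.filter (fun p => p ≠ 2 ∧ p ≠ l) ∪ ({2, l} ∪ ({3, 5} \ I)) := ⟨_, rfl⟩
  have hPs_prime : ∀ p ∈ Ps, p.Prime := by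
    intro p hp
    rw [hPs] at hp
    rcases Finset.mem_union.mp hp with h | h
    · exact hI p (Finset.mem_filter.mp h).1
    · rcases Finset.mem_union.mp h with h | h
      · rcases Finset.mem_insert.mp h with rfl | h
        · exact Nat.prime_two
        · rw [Finset.mem_singleton] at h; subst h; exact hl
      · have h35 := (Finset.mem_sdiff.mp h).1
        rcases Finset.mem_insert.mp h35 with rfl | h35
        · norm_num
        · rw [Finset.mem_singleton] at h35; subst h35; norm_num
  obtain ⟨m', hm'⟩ : ∃ m' : ℕ → ℕ, m' = fun p =>
      if p ∈ I ∧ (p ≠ 2 ∧ p ≠ l) then l * Nat.lcm (30 / Nat.gcd 30 (e p)) (if p = 3 then 2 else if p = 5 then 4 else 1)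
      else if p = l then l - 1 else if p = 5 then 4 else 2 := ⟨_, rfl⟩
  have hcpos : ∀ p, 0 < (if p = 3 then 2 else if p = 5 then 4 else 1 : ℕ) := by
    intro p; split_ifs <;> norm_num
  have hrpos : ∀ p, 0 < 30 / Nat.gcd 30 (e p) := fun p =>
    Nat.div_pos (Nat.gcd_le_left _ (by norm_num)) (Nat.gcd_pos_of_pos_left _ (by norm_num))
  have hlcmpos : ∀ p, 0 < Nat.lcm (30 / Nat.gcd 30 (e p)) (if p = 3 then 2 else if p = 5 then 4 else 1) :=
    fun p => Nat.lcm_pos (hrpos p) (hcpos p)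
  -- values of the weights
  have hmA : ∀ p ∈ I.filter (fun p => p ≠ 2 ∧ p ≠ l),
      m' p = l * Nat.lcm (30 / Nat.gcd 30 (e p)) (if p = 3 then 2 else if p = 5 then 4 else 1) := by
    intro p hp
    obtain ⟨hpI, hp2l⟩ := Finset.mem_filter.mp hp
    simp only [hm', if_pos (And.intro hpI hp2l)]
  have hm2 : m' 2 = 2 := by simp [hm', Ne.symm hl2]
  have hml : m' l = l - 1 := by simp [hm']
  have hm3 : 3 ∉ I → m' 3 = 2 := fun h3 => by simp [hm', h3, Ne.symm hl3]
  have hm5 : 5 ∉ I → m' 5 = 4 := fun h5 => by simp [hm', h5, Ne.symm hl5]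
  have hm'pos : ∀ p, 0 < m' p := by
    intro p
    by_cases hA : p ∈ I ∧ (p ≠ 2 ∧ p ≠ l)
    · have hv : m' p = l * Nat.lcm (30 / Nat.gcd 30 (e p)) (if p = 3 then 2 else if p = 5 then 4 else 1) := by
        simp only [hm', if_pos hA]
      rw [hv]; exact Nat.mul_pos hl.pos (hlcmpos p)
    · by_cases hpl : p = l
      · have hv : m' p = l - 1 := by simp only [hm', if_neg hA, if_pos hpl]
        rw [hv]; omega
      · by_cases hp5 : p = 5
        · have hv : m' p = 4 := by simp only [hm', if_neg hA, if_neg hpl, if_pos hp5]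
          rw [hv]; norm_num
        · have hv : m' p = 2 := by simp only [hm', if_neg hA, if_neg hpl, if_neg hp5]
          rw [hv]; norm_num
  -- the places of `F_tpd = ℚ` over `Ps`, and their weights
  obtain ⟨f, hf⟩ : ∃ f : {p // p ∈ Ps} → HeightOneSpectrum (𝓞 ℚ),
      f = fun pp => (primesEquiv (R := 𝓞 ℚ)).symm ⟨pp.1, hPs_prime pp.1 pp.2⟩ := ⟨_, rfl⟩
  have hgen : ∀ pp : {p // p ∈ Ps}, natGenerator (f pp) = pp.1 := fun pp => by
    rw [hf]; exact congrArg Subtype.val ((primesEquiv (R := 𝓞 ℚ)).apply_symm_apply ⟨pp.1, hPs_prime pp.1 pp.2⟩)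
  have hfinj : Function.Injective f := by
    intro a b hab
    have h := congrArg (fun v => natGenerator (R := 𝓞 ℚ) v) hab
    simp only [hgen] at h
    exact Subtype.ext h
  have hmemf : ∀ pp : {p // p ∈ Ps}, ((pp.1 : ℕ) : 𝓞 ℚ) ∈ (f pp).asIdeal := fun pp =>
    (natCast_mem_asIdeal_iff (f pp) pp.1).2 (by rw [hgen pp])
  obtain ⟨S, hS⟩ : ∃ S : Finset (HeightOneSpectrum (𝓞 ℚ)), S = Ps.attach.image f := ⟨_, rfl⟩
  obtain ⟨m, hm⟩ : ∃ m : HeightOneSpectrum (𝓞 ℚ) → ℕ, m = fun v => m' (natGenerator v) := ⟨_, rfl⟩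
  have hmS : ∀ v ∈ S, 0 < m v := fun v _ => by rw [hm]; exact hm'pos _
  -- the ramification hypothesis (stated over the point's `F_tpd`): every weight divides `e(w ∣ v)`
  have hram : ∀ v : HeightOneSpectrum (𝓞 (ratPoint q).F), v ∈ S →
      ∀ w ∈ IsDedekindDomain.primesOverFinset v.asIdeal (𝓞 T.K), m v ≤ ramificationIdx' v.asIdeal w := by
    intro v hv w hw
    rw [hS] at hv
    obtain ⟨pp, -, rfl⟩ := Finset.mem_image.mp hv
    obtain ⟨p, hp⟩ := pp
    have hmv : m (f ⟨p, hp⟩) = m' p := by simp only [hm, hgen]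
    rw [hmv]
    refine ThetaVolumeDatumAt.le_ramificationIdx'_of_dvd T (f ⟨p, hp⟩) hw ?_
    have hmem : ((p : ℕ) : 𝓞 (ratPoint q).F) ∈ (f ⟨p, hp⟩).asIdeal := hmemf ⟨p, hp⟩
    have hp' := hp
    rw [hPs] at hp'
    rcases Finset.mem_union.mp hp' with hpA | hpBC
    · -- a bad prime `p ≠ 2, l`: weight `l·lcm(30/gcd(30,e_p), c_p)`
      obtain ⟨hpI, hp2, hpl⟩ := Finset.mem_filter.mp hpA
      have hpp := hI p hpI
      rw [hmA p hpA]
      -- `l ∣ e(w ∣ v)`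
      have hbad : f ⟨p, hp⟩ ∈ badPlacesAvoid (ratPoint q) {2, l} := by
        have hpS : ∀ s ∈ ({2, l} : Finset ℕ), ¬ p ∣ s := by
          intro s hs hps
          simp only [Finset.mem_insert, Finset.mem_singleton] at hs
          rcases hs with rfl | rfl
          · exact hp2 ((Nat.prime_dvd_prime_iff_eq hpp Nat.prime_two).mp hps)
          · exact hpl ((Nat.prime_dvd_prime_iff_eq hpp hl).mp hps)
        rw [hf]
        exact primesEquiv_symm_mem_badPlacesAvoid_ratPoint hI he hD hj hN {2, l} hpI (hcop p hpI) hpS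
      have hldvd := ThetaVolumeDatumAt.l_dvd_ramificationIdx'_of_mem_badPlacesAvoid T (f ⟨p, hp⟩) hbad w hw
      -- `lcm(30/gcd(30,e_p), c_p) ∣ e(w ∣ v)`
      have hkF : ∀ x : HeightOneSpectrum (𝓞 T.F), ((p : ℕ) : 𝓞 T.F) ∈ x.asIdeal →
          Nat.lcm (30 / Nat.gcd 30 (e p)) (if p = 3 then 2 else if p = 5 then 4 else 1) ∣
            x.asIdeal.ramificationIdx ℤ := by
        intro x hx
        refine Nat.lcm_dvd (T.div_gcd_thirty_dvd_ramificationIdx_F hI he hD hj hN hpI (hcop p hpI) x hx) ?_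
        by_cases h3 : p = 3
        · rw [if_pos h3]; subst h3
          exact T.sub_one_dvd_ramificationIdx_int (by norm_num) (by norm_num) x hx
        · rw [if_neg h3]
          by_cases h5 : p = 5
          · rw [if_pos h5]; subst h5
            exact T.sub_one_dvd_ramificationIdx_int (by norm_num) (by norm_num) x hx
          · rw [if_neg h5]; exact one_dvd _
      have hkdvd := T.dvd_ramificationIdx'_ratPoint_of_forall hkF (f ⟨p, hp⟩) hmem w hw
      -- `l` is prime to `lcm(…) ∣ 60`
      have hcop60 : Nat.Coprime (Nat.lcm (30 / Nat.gcd 30 (e p)) (if p = 3 then 2 else if p = 5 then 4 else 1)) l := by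
        have h60 : Nat.lcm (30 / Nat.gcd 30 (e p)) (if p = 3 then 2 else if p = 5 then 4 else 1) ∣ 60 := by
          refine Nat.lcm_dvd ((Nat.div_dvd_of_dvd (Nat.gcd_dvd_left 30 (e p))).trans (by norm_num)) ?_
          split_ifs <;> norm_num
        have hc : Nat.Coprime 60 l := by
          have h2 : Nat.Coprime 2 l := (Nat.coprime_primes Nat.prime_two hl).mpr hl2.symm
          have h3 : Nat.Coprime 3 l := (Nat.coprime_primes (by norm_num) hl).mpr hl3.symm
          have h5 : Nat.Coprime 5 l := (Nat.coprime_primes (by norm_num) hl).mpr hl5.symm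
          have : (60 : ℕ) = 2 * 2 * 3 * 5 := by norm_num
          rw [this]
          exact ((h2.mul_left h2).mul_left h3).mul_left h5
        exact Nat.Coprime.coprime_dvd_left h60 hc
      rw [mul_comm]
      exact hcop60.mul_dvd_of_dvd_of_dvd hkdvd hldvd
    · rcases Finset.mem_union.mp hpBC with hpB | hpC
      · rcases Finset.mem_insert.mp hpB with rfl | hpB
        · -- `p = 2`: weight `2` (`√−1 ∈ F`)
          rw [hm2]
          exact T.two_dvd_ramificationIdx'_ratPoint (f ⟨2, hp⟩) hmem w hw
        · -- `p = l`: weight `l − 1` (`μ_l ⊂ K`)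
          rw [Finset.mem_singleton] at hpB
          subst hpB
          rw [hml]
          exact T.sub_one_dvd_ramificationIdx'_ratPoint_l (f ⟨p, hp⟩) hmem w hw
      · -- `p ∈ {3, 5} ∖ I`: weights `2`, `4` (`μ₃₀ ⊂ F`)
        obtain ⟨h35, hnot⟩ := Finset.mem_sdiff.mp hpC
        rcases Finset.mem_insert.mp h35 with rfl | h35
        · rw [hm3 hnot]
          exact T.sub_one_dvd_ramificationIdx'_ratPoint_of_dvd_thirty (by norm_num) (by norm_num) (f ⟨3, hp⟩) hmem w hw
        · rw [Finset.mem_singleton] at h35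
          subst h35
          rw [hm5 hnot]
          exact T.sub_one_dvd_ramificationIdx'_ratPoint_of_dvd_thirty (by norm_num) (by norm_num) (f ⟨5, hp⟩) hmem w hw
  -- the weight sum, read over the primes
  have hsum : ∑ v ∈ S, (1 - (m v : ℝ)⁻¹) * Real.log (absNorm v.asIdeal : ℝ) =
      (∑ p ∈ I.filter (fun p => p ≠ 2 ∧ p ≠ l),
          (1 - ((l * Nat.lcm (30 / Nat.gcd 30 (e p)) (if p = 3 then 2 else if p = 5 then 4 else 1) : ℕ) : ℝ)⁻¹)
            * Real.log p)
        + 2⁻¹ * Real.log 2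
        + (if 3 ∈ I then 0 else 2⁻¹ * Real.log 3)
        + (if 5 ∈ I then 0 else (3 / 4 : ℝ) * Real.log 5)
        + (1 - ((l - 1 : ℕ) : ℝ)⁻¹) * Real.log l := by
    rw [hS, Finset.sum_image fun a _ b _ hab => hfinj hab]
    have h1 : ∑ pp ∈ Ps.attach, (1 - (m (f pp) : ℝ)⁻¹) * Real.log (absNorm (f pp).asIdeal : ℝ) =
        ∑ pp ∈ Ps.attach, (1 - (m' pp.1 : ℝ)⁻¹) * Real.log pp.1 := by
      refine Finset.sum_congr rfl fun pp _ => ?_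
      rw [absNorm_asIdeal_eq_natGenerator (f pp), hm]
      simp only [hgen]
    rw [h1, Finset.sum_attach Ps (fun p => (1 - (m' p : ℝ)⁻¹) * Real.log p), hPs]
    exact sum_weights_eq h7 m' hmA hm2 hml hm3 hm5
  refine T.cor312PerImageOf_of_le_weighted hUP.1.1
    (by rw [hd1]; have : (7 : ℝ) ≤ l := by exact_mod_cast h7
        push_cast; linarith) S m hmS hram ?_
  have harch : ThetaVolumeInput.archLogTheta l = ((l : ℝ) + 5) / 4 * Real.log Real.pi := rfl
  have hld : (ratPoint q).logDiff = 0 := by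
    rw [NFPoint.logDiff_eq_log_discr]
    change ((Module.finrank ℚ ℚ : ℕ) : ℝ)⁻¹ * Real.log ((NumberField.discr ℚ).natAbs : ℕ) = 0
    rw [Rat.numberField_discr]
    simp
  rw [harch, hd1, hld, degree_ratPoint]
  push_cast
  simp only [inv_one, one_mul, zero_add]
  convert h using 3
  exact hsum

end Literature.IUT.LogVolume.Cor22

end
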